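import Literature.MathematicalPhysics.QuantumFieldTheory.BalabanImbrieJaffe1984to88.BIJ88SlotLeibniz308
import Literature.MathematicalPhysics.QuantumFieldTheory.BalabanImbrieJaffe1984to88.BIJ88PertTerms5141

/-!
# `BalabanImbrieJaffe1984to88.BIJ88SlotMoments308` — [BalabanImbrieJaffe1988] CMP **114** (1988), Sect. 5.14 p. 308 [PDF 52]:
**the slot moments `⟨Π_{j∈K}(d/dt)_{γ_j}⟩_t` of the p. 308 family and `Σ_γ ⟨Π_{j∈K}(d/dt)_{γ_j}⟩_t = z_t^{(|K|)}/z_t`.**  The family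
`z_t = ∫ χ′_{Λ,t} e^{−tṼ} dP`, `χ′_{Λ,t} = Π_{b∈Λ} χ(c_b p(te_k), Φ_b)`, `Ṽ = Σ_Y V(Y)`, is the expectation of a PRODUCT OVER SLOTS (the χ-factors
`b`, the terms `Y`); the expectations with the insertions `Π_{j∈K}(d/dt)_{γ_j}` (each slot differentiated as often as `K` assigns labels to
it), normalized by `z_t` (*"⟨·⟩_t = (1/z_t)⟨· χ′ e^{−tṼ}⟩_1"*), sum over the assignments to `z_t^{(|K|)}/z_t` — Leibniz over assignments
(`BIJ88SlotLeibniz308`) + all orders under the integral sign (gen 7) —: the hypotheses `hN`, `hκloc` of gen 9's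
`…5142Slots.sum_asg_trunc_eq_iteratedDerivWithin_log` DISCHARGED for the family.  Hence **for ANY `κ_t(·,γ)` solving p. 310 display 2 per
assignment against these moments: `Σ_γ κ_t(H,γ) = (d/dt)^{n̄+1} log z_t` on the branch, r16's printed (5.14.2) remainder
`remR(Σ_γ κ_t) = −(1/(n̄+1))·∫₀¹((1−t)^{n̄}/n̄!)(log z)^{(n̄+1)}`, and (gen-8 Gaussian hypotheses) `−log z₁ = 𝒫̃_{k+1} + (n̄+1)·remR(Σ_γ κ_t)`.**

statement-level skeleton of published theorems with citation tags; proofs where landed; nothing here is a claim about the Yang–Mills mass gap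

THE PRINT (verbatim, p. 308 [PDF 52]; image `lit-balaban-r16/renders/cmp114/original-p052-x2.png`, text layer re-read this session):
*"Define z_t(Λ₁₂^{(k)}) for t ∈ [0,1] by replacing Ṽ(Λ₁₂^{(k)}) with tṼ(Λ₁₂^{(k)}), replacing χ(cp(e_k), (I−Q^{s*}Q)A^{(k)}) with
χ(cp(te_k), (I−Q^{s*}Q)A^{(k)}), and similarly for χ(cp(e_k), φ^{(k)}). … and a remainder ℛ_k(Λ₁₂^{(k)}) = ∫₀¹ dt −((1−t)^{n̄}/(n̄+1)!)
⟨d/dt; …; d/dt⟩_t. (5.14.2) Here ⟨·⟩_t is the interacting expectation ⟨·⟩_t = (1/z_t(Λ₁₂^{(k)})) ⟨· χ′_{Λ₁₂^{(k)},t} e^{−tṼ^{(k)}(Λ^{(k)}_{12})}⟩_{1,Λ₁₂^{(k)}},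
with χ′_{Λ₁₂^{(k)},t} defined as above replacing p(e_k) with p(te_k). We express each d/dt as a sum Σ_γ (d/dt)_γ, where (d/dt)_γ acts only on
the t before a particular term V^{(k)}(Y) in Ṽ^{(k)} or in a particular χ-factor."* (p. 308: *"Ṽ^{(k)}(Λ₁₂^{(k)}) = Σ_{Y⊂Λ₁₂^{(k)}} V^{(k)}(Y)"*).

WHAT IS PROVED (definitions with bodies `slotFactor`, `zt`, `slotMoment`; theorems; no `Prop` fact).  §1 the slot factors (`inl b`:
`s ↦ χ(c_b p(se_k), Φ_b(ω))`; `inr Y`: `s ↦ e^{−sV_Y(ω)}`), `prod_slotFactor` (`Π_τ = χ′_{Λ,s}·e^{−sṼ}`), smoothness on the branch, field-uniform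
bounds of all `t`-derivatives, pointwise Leibniz over `asg`.  §2 `zt` = the gen-7/8 family with `W = Σ_Y V_Y` (`zt_eq`); integrability of the
differentiated products; `contDiffAt_zt`, `zt_pos` (gen 8 BY NAME), `zt_zero`, `contDiffOn_uIcc_log_zt`.  §3 `slotMoment` = `⟨Π_{j∈K}(d/dt)_{γ_j}⟩_t`,
slot-local (`slotMoment_congr`); **`sum_asg_integral_eq_iteratedDeriv_zt`**, **`sum_asg_slotMoment`** (`Σ_{γ∈asg s₀ K} ⟨Π_{j∈K}(d/dt)_{γ_j}⟩_t =
z_t^{(|K|)}/z_t`; branch `0 < t`, `te_k < e^{−1}`; ANY finite measure, measurable fields, `c_b ≠ 0`, measurable `|V_Y| ≤ K_Y`).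
§4 **`sum_asg_trunc_eq_iteratedDeriv_log_zt`** / **`sum_trunc_univ_eq_iteratedDeriv_log_zt`** (`Σ_{γ∈asg s₀ K} κ(K,γ) = (d/dt)^{|K|} log z_t`
for every `κ(·,γ)` solving display 2 per `γ`; `t` in any set of unique differentiability `s ⊆ (0, e^{−1}/e_k)` with `z > 0` on `s`),
**`remR_sum_trunc_eq_zt`** (integrands equal on `(0,1]`; the located `(n̄+1)!` slip GAPS G-C2-p36-06), **`effectiveAction_eq_pertP_add_sum_slotTrunc`**.

HONEST SCOPE.  The only hypothesis on the truncated functions is their DEFINITION (display 2 per assignment, p. 310); the cluster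
expansion (5.14.3) of each `⟨…⟩_t` (p25's `BIJ88Expansion5143*`) and (5.14.4) are neither used nor asserted; at `t = 0` the slot factors
are not differentiable, so the statements live on the branch / on `(0,1]` (a.e. for the remainder integral).  0 `sorry`; axioms standard.

CITATION HEADER (lean-in-tree rule).  lit-balaban TYPED SKELETON (HOME `run/shared/lean/pub/lit-balaban/`), Phase 2, seat p36 gen 10
(unit `lit-balaban-p36`); rows **C2.Eq5.14.1-5.14.2** ((5.14.2)) and **C2.Claim@310** (display 2) of `HOME/lit-balaban-r16/ROWS-C2-part2.md`
(owner r16; heads untouched).  PDF held: `paper:balaban1988-cmp114-bij-abelian-higgs-effective-action` (journal page = PDF page + 256).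
NOT summit progress.
-/

open Finset MeasureTheory ProbabilityTheory
open Literature.Probability.LatticeModels (IsSetPartition setPartitions mem_setPartitions)
open Literature.MathematicalPhysics.QuantumFieldTheory.BalabanImbrieJaffe1984to88.BIJ88TruncatedExpectation5142
open Literature.MathematicalPhysics.QuantumFieldTheory.BalabanImbrieJaffe1984to88.BIJ88SlotLeibniz308

noncomputable section

namespace Literature.MathematicalPhysics.QuantumFieldTheory.BalabanImbrieJaffe1984to88.BIJ88SlotMoments308

open BIJ88Sect2Statements (pLog)
open BIJ88Sect5Statements (CutoffProfile cutoff)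
open BIJ88Sect5StatementsPart4 (remR pertP taylor_logz)
open BIJ88RestrictedInteractionAllOrders308 (contDiff_expWeight iteratedDeriv_expWeight)

variable (χ : CutoffProfile) {ι υ Ω : Type*}

/-! ## §1 The slot factors: the χ-factors `b ∈ Λ` and the terms `Y` of `Ṽ = Σ_Y V(Y)` -/

/-- **The slot factors of the p. 308 integrand** `χ′_{Λ,s} e^{−sṼ} = Π_{b∈Λ} χ(c_b p(se_k), Φ_b) · Π_Y e^{−sV(Y)}` at the field
configuration `ω`: the slot `inl b` carries `s ↦ χ(c_b p(se_k), Φ_b(ω))`, the slot `inr Y` carries `s ↦ e^{−sV_Y(ω)}` (*"(d/dt)_γ acts only on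
the t before a particular term V^{(k)}(Y) in Ṽ^{(k)} or in a particular χ-factor"*). [cite: BalabanImbrieJaffe1988, (5.14.2) p.308] -/
def slotFactor (p ek : ℝ) (B : Finset ι) (Φ : ι → Ω → ℝ) (c : ι → ℝ) (Ys : Finset υ) (V : υ → Ω → ℝ) (ω : Ω) :
    ↥B ⊕ ↥Ys → ℝ → ℝ
  | Sum.inl b => fun s => cutoff χ (c b * pLog p (s * ek)) (Φ b ω)
  | Sum.inr Y => fun s => Real.exp (-(s * V Y ω))

variable (p ek : ℝ) (B : Finset ι) (Φ : ι → Ω → ℝ) (c : ι → ℝ) (Ys : Finset υ) (V : υ → Ω → ℝ)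

/-- the χ-slot. [cite: BalabanImbrieJaffe1988, (5.14.2) p.308] -/
theorem slotFactor_inl (ω : Ω) (b : B) :
    slotFactor χ p ek B Φ c Ys V ω (Sum.inl b) = fun s => cutoff χ (c b * pLog p (s * ek)) (Φ b ω) := rfl

/-- the `V(Y)`-slot. [cite: BalabanImbrieJaffe1988, (5.14.2) p.308] -/
theorem slotFactor_inr (ω : Ω) (Y : Ys) :
    slotFactor χ p ek B Φ c Ys V ω (Sum.inr Y) = fun s => Real.exp (-(s * V Y ω)) := rfl

/-- **The product over the slots is the p. 308 integrand** `χ′_{Λ,s}·e^{−sṼ}`, `Ṽ = Σ_{Y∈Ys} V_Y`. [cite: BalabanImbrieJaffe1988, (5.14.2) p.308] -/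
theorem prod_slotFactor (ω : Ω) (s : ℝ) :
    ∏ τ, slotFactor χ p ek B Φ c Ys V ω τ s =
      (∏ b ∈ B, cutoff χ (c b * pLog p (s * ek)) (Φ b ω)) * Real.exp (-(s * ∑ Y ∈ Ys, V Y ω)) := by
  rw [Fintype.prod_sum_type]; simp only [slotFactor_inl, slotFactor_inr]
  rw [Finset.prod_coe_sort B (fun b => cutoff χ (c b * pLog p (s * ek)) (Φ b ω)),
    Finset.prod_coe_sort Ys (fun Y => Real.exp (-(s * V Y ω))), ← Real.exp_sum, Finset.mul_sum,
    ← Finset.sum_neg_distrib]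

variable {p ek B Φ c Ys V}

/-- Every slot factor is `Cⁿ` on the open branch `0 < s`, `se_k < 1`, every `n`. [cite: BalabanImbrieJaffe1988, (5.14.2) p.308] -/
theorem contDiffOn_slotFactor (hek : 0 < ek) (n : ℕ) (ω : Ω) (τ : ↥B ⊕ ↥Ys) :
    ContDiffOn ℝ n (slotFactor χ p ek B Φ c Ys V ω τ) {s : ℝ | 0 < s ∧ s * ek < 1} := by
  rcases τ with b | Y
  · exact BIJ88GaussIntegration309Product.contDiffOn_cutoff_t χ p (Φ b ω) (c b) hek n
  · exact (contDiff_expWeight (V Y ω) n).contDiffOn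

/-- Every `t`-derivative of every slot factor is bounded in the field on the branch `0 < t`, `te_k ≤ e^{−1}` (`c_b ≠ 0`, `|V_Y| ≤ K_Y`):
χ-slots by gen 7's `Ĉt^{−m}` (`BIJ88GaussIntegration309Product.exists_const_all_orders`), `V(Y)`-slots by `K_Y^m e^{tK_Y}`.
[cite: BalabanImbrieJaffe1988, (5.14.2) p.308] -/
theorem exists_abs_iteratedDeriv_slotFactor_le (hc : ∀ b ∈ B, c b ≠ 0) {KY : υ → ℝ}
    (hK : ∀ Y ∈ Ys, ∀ ω, |V Y ω| ≤ KY Y) (hek : 0 < ek) (m : ℕ) {t : ℝ} (ht : 0 < t) (h1 : t * ek ≤ Real.exp (-1))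
    (τ : ↥B ⊕ ↥Ys) : ∃ C : ℝ, ∀ ω, |iteratedDeriv m (slotFactor χ p ek B Φ c Ys V ω τ) t| ≤ C := by
  rcases τ with ⟨b, hb⟩ | ⟨Y, hY⟩
  · obtain ⟨C, -, hC⟩ := BIJ88GaussIntegration309Product.exists_const_all_orders χ p m
    exact ⟨C * t ^ (-(m : ℤ)), fun ω => hC m le_rfl (Φ b ω) (hc b hb) hek ht h1⟩
  · refine ⟨KY Y ^ m * Real.exp (t * KY Y), fun ω => ?_⟩
    simp only [slotFactor_inr, iteratedDeriv_expWeight]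
    have hVK := hK Y hY ω; have hlo : -KY Y ≤ V Y ω := (abs_le.1 hVK).1
    rw [abs_mul, abs_pow, abs_neg, abs_of_pos (Real.exp_pos _)]
    exact mul_le_mul (pow_le_pow_left₀ (abs_nonneg _) hVK m) (Real.exp_le_exp.2 (by nlinarith)) (Real.exp_pos _).le
      (pow_nonneg ((abs_nonneg _).trans hVK) m)

omit χ in
/-- `|Ṽ| ≤ Σ_Y K_Y` for `|V_Y| ≤ K_Y`. [cite: BalabanImbrieJaffe1988, (5.14.2) p.308] -/
theorem abs_sumV_le {KY : υ → ℝ} (hK : ∀ Y ∈ Ys, ∀ ω, |V Y ω| ≤ KY Y) (ω : Ω) :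
    |∑ Y ∈ Ys, V Y ω| ≤ ∑ Y ∈ Ys, KY Y :=
  (Finset.abs_sum_le_sum_abs _ _).trans (Finset.sum_le_sum fun Y hY => hK Y hY ω)

section Pointwise

variable [DecidableEq ι] [DecidableEq υ]

/-- **Leibniz over assignments for the integrand, pointwise in the field** on the branch `0 < t`, `te_k < 1`:
`Σ_{γ ∈ asg s₀ K} Π_τ ∂_t^{#{j∈K : γ j = τ}} slotFactor_τ(ω) = ∂_t^{|K|} (Π_τ slotFactor_τ(ω))`. [cite: BalabanImbrieJaffe1988, (5.14.2) p.308] -/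
theorem sum_asg_prod_iteratedDeriv_slotFactor {α : Type*} [Fintype α] [DecidableEq α] (s₀ : ↥B ⊕ ↥Ys) (K : Finset α)
    (hek : 0 < ek) {t : ℝ} (ht : 0 < t) (h1 : t * ek < 1) (ω : Ω) :
    ∑ γ ∈ asg s₀ K, ∏ τ, iteratedDeriv ((K.filter fun j => γ j = τ).card) (slotFactor χ p ek B Φ c Ys V ω τ) t =
      iteratedDeriv K.card (fun s => ∏ τ, slotFactor χ p ek B Φ c Ys V ω τ s) t :=
  sum_asg_prod_iteratedDeriv s₀ (BIJ88ChiTDerivN309.isOpen_branch ek) K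
    (fun τ => contDiffOn_slotFactor χ hek K.card ω τ) ⟨ht, h1⟩

end Pointwise

/-! ## §2 `z_t` as the expectation of the product of the slot factors -/

section Measure

variable [MeasurableSpace Ω]

variable (p ek B Φ c Ys V) in
/-- **`z_t = ∫ Π_τ slotFactor_τ dP`** — the p. 308 family `z_t = ⟨χ′_{Λ,t} e^{−tṼ}⟩_1` written over the slots.
[cite: BalabanImbrieJaffe1988, (5.14.2) p.308] -/
def zt (P : Measure Ω) (t : ℝ) : ℝ := ∫ ω, ∏ τ, slotFactor χ p ek B Φ c Ys V ω τ t ∂P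

/-- `z_t` IS the gen-7/8 restricted interacting family with `W = Σ_{Y∈Ys} V_Y`. [cite: BalabanImbrieJaffe1988, (5.14.2) p.308] -/
theorem zt_eq (P : Measure Ω) : zt χ p ek B Φ c Ys V P = fun t =>
    ∫ ω, (∏ b ∈ B, cutoff χ (c b * pLog p (t * ek)) (Φ b ω)) * Real.exp (-(t * ∑ Y ∈ Ys, V Y ω)) ∂P := by
  funext t; simp_rw [zt, prod_slotFactor]

omit χ in
/-- `Ṽ = Σ_Y V_Y` is measurable. [cite: BalabanImbrieJaffe1988, (5.14.2) p.308] -/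
theorem measurable_sumV (hV : ∀ Y ∈ Ys, Measurable (V Y)) : Measurable fun ω => ∑ Y ∈ Ys, V Y ω :=
  Finset.measurable_sum Ys fun Y hY => hV Y hY

/-- Every `t`-derivative of every slot factor is measurable in the field. [cite: BalabanImbrieJaffe1988, (5.14.2) p.308] -/
theorem measurable_iteratedDeriv_slotFactor (hΦ : ∀ b ∈ B, Measurable (Φ b)) (hV : ∀ Y ∈ Ys, Measurable (V Y))
    (hek : 0 < ek) (m : ℕ) {t : ℝ} (ht : 0 < t) (h1 : t * ek < 1) (τ : ↥B ⊕ ↥Ys) :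
    Measurable fun ω => iteratedDeriv m (slotFactor χ p ek B Φ c Ys V ω τ) t := by
  rcases τ with ⟨b, hb⟩ | ⟨Y, hY⟩
  · have h := BIJ88RestrictionsAllOrders308.measurable_iteratedDeriv_prod_cutoff_t χ p ({b} : Finset ι)
      (Φ := Φ) (fun b' hb' => by rw [Finset.mem_singleton.1 hb']; exact hΦ b hb) c hek m ht h1
    simpa only [Finset.prod_singleton, slotFactor_inl] using h
  · simp only [slotFactor_inr, iteratedDeriv_expWeight]
    exact ((hV Y hY).neg.pow_const m).mul (Real.measurable_exp.comp ((hV Y hY).const_mul t).neg)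

/-- The differentiated products `Π_τ ∂_t^{m_τ} slotFactor_τ` are integrable (finite measure; branch `0 < t`, `te_k < e^{−1}`).
[cite: BalabanImbrieJaffe1988, (5.14.2) p.308] -/
theorem integrable_prod_iteratedDeriv_slotFactor (P : Measure Ω) [IsFiniteMeasure P] (hΦ : ∀ b ∈ B, Measurable (Φ b))
    (hc : ∀ b ∈ B, c b ≠ 0) (hV : ∀ Y ∈ Ys, Measurable (V Y)) {KY : υ → ℝ} (hK : ∀ Y ∈ Ys, ∀ ω, |V Y ω| ≤ KY Y)
    (hek : 0 < ek) {t : ℝ} (ht : 0 < t) (h1 : t * ek < Real.exp (-1)) (m : ↥B ⊕ ↥Ys → ℕ) :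
    Integrable (fun ω => ∏ τ, iteratedDeriv (m τ) (slotFactor χ p ek B Φ c Ys V ω τ) t) P := by
  have h1' : t * ek < 1 := h1.trans (by rw [← Real.exp_zero]; exact Real.exp_lt_exp.mpr (by norm_num))
  choose C hC using fun τ => exists_abs_iteratedDeriv_slotFactor_le χ hc hK hek (m τ) ht h1.le τ
  have hmeas : Measurable fun ω => ∏ τ, iteratedDeriv (m τ) (slotFactor χ p ek B Φ c Ys V ω τ) t :=
    Finset.measurable_fun_prod _ fun τ _ => measurable_iteratedDeriv_slotFactor χ hΦ hV hek (m τ) ht h1' τ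
  refine (integrable_const (∏ τ, C τ)).mono' hmeas.aestronglyMeasurable (Filter.Eventually.of_forall fun ω => ?_)
  rw [Real.norm_eq_abs, Finset.abs_prod]
  exact Finset.prod_le_prod (fun τ _ => abs_nonneg _) fun τ _ => hC τ ω

/-- `z` is `Cⁿ` at every point of the branch `0 < t`, `te_k < e^{−1}`. [cite: BalabanImbrieJaffe1988, (5.14.2) p.308] -/
theorem contDiffAt_zt (P : Measure Ω) [IsFiniteMeasure P] (hΦ : ∀ b ∈ B, Measurable (Φ b))
    (hc : ∀ b ∈ B, c b ≠ 0) (hV : ∀ Y ∈ Ys, Measurable (V Y)) {KY : υ → ℝ} (hK : ∀ Y ∈ Ys, ∀ ω, |V Y ω| ≤ KY Y)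
    (hek : 0 < ek) (n : ℕ) {t : ℝ} (ht : 0 < t) (h1 : t * ek < Real.exp (-1)) :
    ContDiffAt ℝ n (zt χ p ek B Φ c Ys V P) t := by
  rw [zt_eq]; exact BIJ88GaussianMoments308.contDiffAt_integral_restrictedInteraction χ p P B hΦ hc (measurable_sumV hV)
    (abs_sumV_le hK) hek n ht h1

/-- **`z_t > 0`** on the branch under the gen-8 hypotheses (non-negative profile, centered jointly Gaussian fields, `c_b ≥ c₀ > 0`,
measurable `|V_Y| ≤ K_Y`): `BIJ88ZtPositivity308.integral_restrictedInteraction_pos` BY NAME. [cite: BalabanImbrieJaffe1988, (5.14.2) p.308] -/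
theorem zt_pos (hχ : ∀ x, 0 ≤ χ.χ₁ x) (hp : 0 ≤ p) (P : Measure Ω) [IsProbabilityMeasure P]
    (hJ : HasGaussianLaw (fun ω (b : B) => Φ b ω) P) (hΦ : ∀ b ∈ B, Measurable (Φ b)) (h0 : ∀ b ∈ B, P[Φ b] = 0)
    {c₀ : ℝ} (hc₀ : 0 < c₀) (hcb : ∀ b ∈ B, c₀ ≤ c b) (hV : ∀ Y ∈ Ys, Measurable (V Y)) {KY : υ → ℝ}
    (hK : ∀ Y ∈ Ys, ∀ ω, |V Y ω| ≤ KY Y) (hek : 0 < ek) {t : ℝ} (ht : 0 < t) (h1 : t * ek ≤ Real.exp (-1)) :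
    0 < zt χ p ek B Φ c Ys V P t := by
  rw [zt_eq]; exact BIJ88ZtPositivity308.integral_restrictedInteraction_pos χ hχ hp P B hJ hΦ h0 hc₀ hcb (measurable_sumV hV)
    (abs_sumV_le hK) hek ht h1

/-- `z_0 = 1` (probability measure, `p ≠ 0`): *"the restrictions and the interactions disappear at t = 0"*. [cite: BalabanImbrieJaffe1988, (5.14.2) p.308] -/
theorem zt_zero (hp : p ≠ 0) (P : Measure Ω) [IsProbabilityMeasure P] : zt χ p ek B Φ c Ys V P 0 = 1 := by
  rw [zt_eq]; exact BIJ88PertTerms5141.integral_restrictedInteraction_at_zero χ hp P B Φ c _ ek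

/-- `log z ∈ Cⁿ([0,1])` (one-sided at the ends) under the gen-8 hypotheses, `e_k < e^{−1}`
(`BIJ88PertTerms5141.contDiffOn_Icc_log_restrictedInteraction'`). [cite: BalabanImbrieJaffe1988, (5.14.2) p.308] -/
theorem contDiffOn_uIcc_log_zt (hχ : ∀ x, 0 ≤ χ.χ₁ x) (hp : 1 / 2 < p) (P : Measure Ω) [IsProbabilityMeasure P]
    (hJ : HasGaussianLaw (fun ω (b : B) => Φ b ω) P) (hΦ : ∀ b ∈ B, Measurable (Φ b)) (h0 : ∀ b ∈ B, P[Φ b] = 0)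
    {c₀ : ℝ} (hc₀ : 0 < c₀) (hcb : ∀ b ∈ B, c₀ ≤ c b) (hV : ∀ Y ∈ Ys, Measurable (V Y)) {KY : υ → ℝ}
    (hK : ∀ Y ∈ Ys, ∀ ω, |V Y ω| ≤ KY Y) (hek : 0 < ek) (hek1 : ek < Real.exp (-1)) (n : ℕ) :
    ContDiffOn ℝ n (fun x => Real.log (zt χ p ek B Φ c Ys V P x)) (Set.uIcc 0 1) := by
  rw [zt_eq, Set.uIcc_of_le zero_le_one]
  exact BIJ88PertTerms5141.contDiffOn_Icc_log_restrictedInteraction' χ hχ hp P B hJ hΦ h0 hc₀ hcb (measurable_sumV hV)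
    (abs_sumV_le hK) hek hek1 n

end Measure

/-! ## §3 The slot moments `⟨Π_{j∈K}(d/dt)_{γ_j}⟩_t` and `Σ_γ ⟨Π_{j∈K}(d/dt)_{γ_j}⟩_t = z_t^{(|K|)}/z_t` -/

section Moments

variable [MeasurableSpace Ω] [DecidableEq ι] [DecidableEq υ]

variable (p ek B Φ c Ys V) in
/-- **The slot moments** `⟨Π_{j∈K}(d/dt)_{γ_j}⟩_t := (1/z_t) ∫ Π_τ ∂_t^{#{j∈K : γ_j = τ}} slotFactor_τ dP` — the interacting expectation
(*"⟨·⟩_t = (1/z_t)⟨· χ′_{Λ,t} e^{−tṼ}⟩_1"*) of the integrand with the insertions `(d/dt)_{γ_j}`, `j ∈ K` (each slot differentiated as often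
as `γ` sends labels of `K` to it). [cite: BalabanImbrieJaffe1988, (5.14.2) p.308] -/
def slotMoment (P : Measure Ω) (t : ℝ) {α : Type*} (K : Finset α) (γ : α → ↥B ⊕ ↥Ys) : ℝ :=
  (∫ ω, ∏ τ, iteratedDeriv ((K.filter fun j => γ j = τ).card) (slotFactor χ p ek B Φ c Ys V ω τ) t ∂P) /
    zt χ p ek B Φ c Ys V P t

/-- The slot moments are SLOT-LOCAL: they depend on the assignment `γ` only through `γ|_K` (the form of p25's `BIJ88Expansion5143.IsSlotLocal`
corner data). [cite: BalabanImbrieJaffe1988, (5.14.2) p.308] -/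
theorem slotMoment_congr (P : Measure Ω) (t : ℝ) {α : Type*} {K : Finset α} {γ γ' : α → ↥B ⊕ ↥Ys}
    (h : ∀ j ∈ K, γ j = γ' j) :
    slotMoment χ p ek B Φ c Ys V P t K γ = slotMoment χ p ek B Φ c Ys V P t K γ' := by
  have hf : ∀ τ, (K.filter fun j => γ j = τ) = K.filter fun j => γ' j = τ := fun τ =>
    Finset.filter_congr fun j hj => by rw [h j hj]
  simp only [slotMoment, hf]

/-- **`Σ_{γ ∈ asg s₀ K} ⟨Π_{j∈K}(d/dt)_{γ_j} χ′_{Λ,t} e^{−tṼ}⟩_1 = z_t^{(|K|)}`** on the branch `0 < t`, `te_k < e^{−1}`: `Σ∫ = ∫Σ` (every term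
integrable), Leibniz over assignments pointwise in the field (`BIJ88SlotLeibniz308.sum_asg_prod_iteratedDeriv`), and gen 7's all-orders exchange
`BIJ88RestrictedInteractionAllOrders308.iteratedDeriv_integral_restrictedInteraction`; ANY finite measure, measurable fields, `c_b ≠ 0`,
measurable `|V_Y| ≤ K_Y`. [cite: BalabanImbrieJaffe1988, (5.14.2) p.308] -/
theorem sum_asg_integral_eq_iteratedDeriv_zt (P : Measure Ω) [IsFiniteMeasure P] (hΦ : ∀ b ∈ B, Measurable (Φ b))
    (hc : ∀ b ∈ B, c b ≠ 0) (hV : ∀ Y ∈ Ys, Measurable (V Y)) {KY : υ → ℝ} (hK : ∀ Y ∈ Ys, ∀ ω, |V Y ω| ≤ KY Y)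
    (hek : 0 < ek) {α : Type*} [Fintype α] [DecidableEq α] (s₀ : ↥B ⊕ ↥Ys) (K : Finset α) {t : ℝ} (ht : 0 < t)
    (h1 : t * ek < Real.exp (-1)) :
    ∑ γ ∈ asg s₀ K, ∫ ω, ∏ τ, iteratedDeriv ((K.filter fun j => γ j = τ).card) (slotFactor χ p ek B Φ c Ys V ω τ) t ∂P
      = iteratedDeriv K.card (zt χ p ek B Φ c Ys V P) t := by
  have h1' : t * ek < 1 := h1.trans (by rw [← Real.exp_zero]; exact Real.exp_lt_exp.mpr (by norm_num))
  rw [← integral_finsetSum _ fun γ _ =>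
    integrable_prod_iteratedDeriv_slotFactor χ P hΦ hc hV hK hek ht h1 fun τ => (K.filter fun j => γ j = τ).card]
  have hpt : (fun ω => ∑ γ ∈ asg s₀ K, ∏ τ, iteratedDeriv ((K.filter fun j => γ j = τ).card)
      (slotFactor χ p ek B Φ c Ys V ω τ) t) = fun ω => iteratedDeriv K.card
        (fun s => (∏ b ∈ B, cutoff χ (c b * pLog p (s * ek)) (Φ b ω)) * Real.exp (-(s * ∑ Y ∈ Ys, V Y ω))) t := by
    funext ω
    rw [sum_asg_prod_iteratedDeriv_slotFactor χ s₀ K hek ht h1' ω]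
    exact congrArg (fun F => iteratedDeriv K.card F t) (funext fun s => prod_slotFactor χ p ek B Φ c Ys V ω s)
  rw [hpt, zt_eq]
  exact (BIJ88RestrictedInteractionAllOrders308.iteratedDeriv_integral_restrictedInteraction χ p P B hΦ hc
    (measurable_sumV hV) (abs_sumV_le hK) hek K.card ht h1).symm

/-- **`Σ_{γ ∈ asg s₀ K} ⟨Π_{j∈K}(d/dt)_{γ_j}⟩_t = z_t^{(|K|)}/z_t`** — the hypothesis `hN` of gen 9's
`…5142Slots.sum_asg_trunc_eq_iteratedDerivWithin_log` for the p. 308 family (branch `0 < t`, `te_k < e^{−1}`).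
[cite: BalabanImbrieJaffe1988, (5.14.2) p.308] -/
theorem sum_asg_slotMoment (P : Measure Ω) [IsFiniteMeasure P] (hΦ : ∀ b ∈ B, Measurable (Φ b))
    (hc : ∀ b ∈ B, c b ≠ 0) (hV : ∀ Y ∈ Ys, Measurable (V Y)) {KY : υ → ℝ} (hK : ∀ Y ∈ Ys, ∀ ω, |V Y ω| ≤ KY Y)
    (hek : 0 < ek) {α : Type*} [Fintype α] [DecidableEq α] (s₀ : ↥B ⊕ ↥Ys) (K : Finset α) {t : ℝ} (ht : 0 < t)
    (h1 : t * ek < Real.exp (-1)) :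
    ∑ γ ∈ asg s₀ K, slotMoment χ p ek B Φ c Ys V P t K γ =
      iteratedDeriv K.card (zt χ p ek B Φ c Ys V P) t / zt χ p ek B Φ c Ys V P t := by
  simp only [slotMoment]; rw [← Finset.sum_div, sum_asg_integral_eq_iteratedDeriv_zt χ P hΦ hc hV hK hek s₀ K ht h1]

/-! ## §4 `Σ_γ ⟨(d/dt)_{γ_1}; …; (d/dt)_{γ_n}⟩_t = (d/dt)ⁿ log z_t` and (5.14.2) for the family -/

/-- **`Σ_{γ ∈ asg s₀ K} ⟨(d/dt)_{γ_{j_1}}; …; (d/dt)_{γ_{j_{|K|}}}⟩_t = (d/dt)^{|K|} log z_t` FOR THE p. 308 FAMILY**: for `t` in a set of unique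
differentiability `s ⊆ (0, e^{−1}/e_k)` with `z > 0` on `s`, and EVERY `κ(·,γ)` solving p. 310 display 2 per assignment `γ` against the slot
moments (`∅ ≠ K ⊆ H`) — their DEFINITION —: gen 9's theorem with `hN` (§3) and `hκloc` (`BIJ88SlotLeibniz308`) DISCHARGED.
[cite: BalabanImbrieJaffe1988, (5.14.2) p.308; p.310 display 2] -/
theorem sum_asg_trunc_eq_iteratedDeriv_log_zt (P : Measure Ω) [IsFiniteMeasure P] (hΦ : ∀ b ∈ B, Measurable (Φ b))
    (hc : ∀ b ∈ B, c b ≠ 0) (hV : ∀ Y ∈ Ys, Measurable (V Y)) {KY : υ → ℝ} (hK : ∀ Y ∈ Ys, ∀ ω, |V Y ω| ≤ KY Y)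
    (hek : 0 < ek) {s : Set ℝ} (hs : UniqueDiffOn ℝ s) (hsub : s ⊆ Set.Ioo 0 (Real.exp (-1) / ek))
    (hzpos : ∀ x ∈ s, 0 < zt χ p ek B Φ c Ys V P x)
    {α : Type*} [Fintype α] [DecidableEq α] (s₀ : ↥B ⊕ ↥Ys) {H : Finset α} {t : ℝ} (ht : t ∈ s)
    {κ : Finset α → (α → ↥B ⊕ ↥Ys) → ℝ}
    (hκ : ∀ γ, ∀ K ⊆ H, K.Nonempty →
      slotMoment χ p ek B Φ c Ys V P t K γ = ∑ π ∈ setPartitions K, ∏ A ∈ π, κ A γ) :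
    ∀ K ⊆ H, K.Nonempty →
      ∑ γ ∈ asg s₀ K, κ K γ = iteratedDeriv K.card (fun x => Real.log (zt χ p ek B Φ c Ys V P x)) t := by
  have hbr : ∀ x ∈ s, 0 < x ∧ x * ek < Real.exp (-1) := fun x hx =>
    ⟨(hsub hx).1, by rw [← lt_div_iff₀ hek]; exact (hsub hx).2⟩
  have hzC : ContDiffOn ℝ H.card (zt χ p ek B Φ c Ys V P) s := fun x hx =>
    (contDiffAt_zt χ P hΦ hc hV hK hek H.card (hbr x hx).1 (hbr x hx).2).contDiffWithinAt
  intro K hKH hKne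
  have hlog : ContDiffAt ℝ K.card (fun x => Real.log (zt χ p ek B Φ c Ys V P x)) t :=
    (Real.contDiffAt_log.mpr (hzpos t ht).ne').comp t (contDiffAt_zt χ P hΦ hc hV hK hek K.card (hbr t ht).1 (hbr t ht).2)
  rw [← iteratedDerivWithin_eq_iteratedDeriv hs hlog ht]
  refine sum_asg_trunc_eq_iteratedDerivWithin_log_of_moment_local hs ht hzC hzpos le_rfl
    (N := fun K γ => slotMoment χ p ek B Φ c Ys V P t K γ)
    (fun K _ γ γ' hγ => slotMoment_congr χ P t hγ) hκ (fun K _ _ => ?_) K hKH hKne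
  rw [iteratedDerivWithin_eq_iteratedDeriv hs (contDiffAt_zt χ P hΦ hc hV hK hek K.card (hbr t ht).1 (hbr t ht).2) ht]
  exact sum_asg_slotMoment χ P hΦ hc hV hK hek s₀ K (hbr t ht).1 (hbr t ht).2

/-- **All labels: `Σ_{γ : H → slots} ⟨(d/dt)_{γ_1}; …; (d/dt)_{γ_n}⟩_t = (d/dt)ⁿ log z_t`** (`n = |H| ≥ 1`), same hypotheses.
[cite: BalabanImbrieJaffe1988, (5.14.2) p.308; p.310 display 2] -/
theorem sum_trunc_univ_eq_iteratedDeriv_log_zt (P : Measure Ω) [IsFiniteMeasure P] (hΦ : ∀ b ∈ B, Measurable (Φ b))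
    (hc : ∀ b ∈ B, c b ≠ 0) (hV : ∀ Y ∈ Ys, Measurable (V Y)) {KY : υ → ℝ} (hK : ∀ Y ∈ Ys, ∀ ω, |V Y ω| ≤ KY Y)
    (hek : 0 < ek) {s : Set ℝ} (hs : UniqueDiffOn ℝ s) (hsub : s ⊆ Set.Ioo 0 (Real.exp (-1) / ek))
    (hzpos : ∀ x ∈ s, 0 < zt χ p ek B Φ c Ys V P x)
    {α : Type*} [Fintype α] [DecidableEq α] [Nonempty α] (s₀ : ↥B ⊕ ↥Ys) {t : ℝ} (ht : t ∈ s)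
    {κ : Finset α → (α → ↥B ⊕ ↥Ys) → ℝ}
    (hκ : ∀ γ, ∀ K : Finset α, K.Nonempty →
      slotMoment χ p ek B Φ c Ys V P t K γ = ∑ π ∈ setPartitions K, ∏ A ∈ π, κ A γ) :
    ∑ γ : α → ↥B ⊕ ↥Ys, κ Finset.univ γ =
      iteratedDeriv (Fintype.card α) (fun x => Real.log (zt χ p ek B Φ c Ys V P x)) t := by
  have h := sum_asg_trunc_eq_iteratedDeriv_log_zt χ P hΦ hc hV hK hek hs hsub hzpos s₀ (H := Finset.univ) ht
    (fun γ K _ hK => hκ γ K hK) Finset.univ Finset.Subset.rfl Finset.univ_nonempty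
  rwa [asg_univ, Finset.card_univ] at h

omit χ in
/-- `(n̄+1)·remR f n̄ = ∫₀¹ −((1−t)^{n̄}/n̄!) f(t) dt`: r16's printed weight `(1−t)^{n̄}/(n̄+1)!` against Taylor's `(1−t)^{n̄}/n̄!` (GAPS G-C2-p36-06).
[cite: BalabanImbrieJaffe1988, (5.14.2) p.308] -/
theorem succ_mul_remR (f : ℝ → ℝ) (nbar : ℕ) :
    (nbar + 1 : ℝ) * remR f nbar = ∫ t in (0 : ℝ)..1, -((1 - t) ^ nbar / nbar.factorial) * f t := by
  rw [remR, ← intervalIntegral.integral_const_mul]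
  refine intervalIntegral.integral_congr fun t _ => ?_
  rw [Nat.factorial_succ]
  push_cast
  have hf : (nbar.factorial : ℝ) ≠ 0 := by exact_mod_cast nbar.factorial_ne_zero
  have hn : ((nbar : ℝ) + 1) ≠ 0 := Nat.cast_add_one_ne_zero nbar
  field_simp

/-- **(5.14.2) for the family with `⟨d/dt;…;d/dt⟩_t := Σ_γ κ_t(H,γ)`** (`κ_t(·,γ)` ANY solution of display 2 per assignment against the slot
moments, `t ∈ (0,1]`; `|H| = n̄+1`, `e_k < e^{−1}`, `z_t > 0` on `(0,1]`, finite measure): r16's printed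
`remR (Σ_γ κ_t) n̄ = −(1/(n̄+1)) ∫₀¹ ((1−t)^{n̄}/n̄!) (d/dt)^{n̄+1} log z_t dt` (one-sided within `[0,1]` as in `taylor_logz`; integrands equal on
`(0,1]`, i.e. a.e.). [cite: BalabanImbrieJaffe1988, (5.14.2) p.308; p.310 display 2] -/
theorem remR_sum_trunc_eq_zt (P : Measure Ω) [IsFiniteMeasure P] (hΦ : ∀ b ∈ B, Measurable (Φ b))
    (hc : ∀ b ∈ B, c b ≠ 0) (hV : ∀ Y ∈ Ys, Measurable (V Y)) {KY : υ → ℝ} (hK : ∀ Y ∈ Ys, ∀ ω, |V Y ω| ≤ KY Y)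
    (hek : 0 < ek) (hek1 : ek < Real.exp (-1)) (hzpos : ∀ x ∈ Set.Ioc (0 : ℝ) 1, 0 < zt χ p ek B Φ c Ys V P x)
    {α : Type*} [Fintype α] [DecidableEq α] {nbar : ℕ} (hα : Fintype.card α = nbar + 1) (s₀ : ↥B ⊕ ↥Ys)
    {κ : ℝ → Finset α → (α → ↥B ⊕ ↥Ys) → ℝ}
    (hκ : ∀ t ∈ Set.Ioc (0 : ℝ) 1, ∀ γ, ∀ K : Finset α, K.Nonempty →
      slotMoment χ p ek B Φ c Ys V P t K γ = ∑ π ∈ setPartitions K, ∏ A ∈ π, κ t A γ) :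
    remR (fun t => ∑ γ : α → ↥B ⊕ ↥Ys, κ t Finset.univ γ) nbar = -(1 / (nbar + 1 : ℝ)) *
      ∫ t in (0 : ℝ)..1, ((1 - t) ^ nbar / nbar.factorial) *
        iteratedDerivWithin (nbar + 1) (fun x => Real.log (zt χ p ek B Φ c Ys V P x)) (Set.uIcc 0 1) t := by
  haveI : Nonempty α := Fintype.card_pos_iff.1 (by omega)
  have hsub : Set.Ioc (0 : ℝ) 1 ⊆ Set.Ioo 0 (Real.exp (-1) / ek) := fun t ht =>
    ⟨ht.1, by rw [lt_div_iff₀ hek]; exact BIJ88PerturbativeRemainder308.mul_lt_exp_neg_one_of_le_one hek hek1 ht.2⟩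
  rw [remR, ← intervalIntegral.integral_const_mul]
  refine intervalIntegral.integral_congr_ae (Filter.Eventually.of_forall fun t ht => ?_)
  rw [Set.uIoc_of_le zero_le_one] at ht
  have htop := sum_trunc_univ_eq_iteratedDeriv_log_zt χ P hΦ hc hV hK hek (uniqueDiffOn_Ioc 0 1) hsub hzpos
    s₀ ht (hκ t ht)
  have hcd : ContDiffAt ℝ (nbar + 1 : ℕ) (fun x => Real.log (zt χ p ek B Φ c Ys V P x)) t :=
    (Real.contDiffAt_log.mpr (hzpos t ht).ne').comp t
      (contDiffAt_zt χ P hΦ hc hV hK hek (nbar + 1) (hsub ht).1 (by rw [← lt_div_iff₀ hek]; exact (hsub ht).2))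
  have hmem : t ∈ Set.uIcc (0 : ℝ) 1 := by rw [Set.uIcc_of_le zero_le_one]; exact ⟨ht.1.le, ht.2⟩
  rw [htop, hα, ← iteratedDerivWithin_eq_iteratedDeriv uniqueDiffOn_uIcc01 hcd hmem, Nat.factorial_succ]
  push_cast
  have hf : (nbar.factorial : ℝ) ≠ 0 := by exact_mod_cast nbar.factorial_ne_zero
  have hn : ((nbar : ℝ) + 1) ≠ 0 := Nat.cast_add_one_ne_zero nbar
  field_simp

/-- **(5.14.1)–(5.14.2) for the p. 308 family in the `Σ_γ` form, NO standing hypothesis beyond gen 8's** (`χ(1,·) ≥ 0`, `p > 1/2`, centered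
jointly Gaussian fields, `c_b ≥ c₀ > 0`, measurable `|V_Y| ≤ K_Y`, `0 < e_k < e^{−1}`) **and the DEFINITION of the truncated functions** (display 2
per assignment, `t ∈ (0,1]`): `−log z₁ = 𝒫̃_{k+1} + (n̄+1)·remR(Σ_γ κ_t)` (located `(n̄+1)!` slip, GAPS G-C2-p36-06) `= 𝒫̃_{k+1} + ∫₀¹ −((1−t)^{n̄}/n̄!) Σ_γ κ_t dt`
(Taylor's weight; `log z_0 = 0`). [cite: BalabanImbrieJaffe1988, (5.14.1) p.308; (5.14.2) p.308; p.310 display 2] -/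
theorem effectiveAction_eq_pertP_add_sum_slotTrunc (hχ : ∀ x, 0 ≤ χ.χ₁ x) (hp : 1 / 2 < p) (P : Measure Ω)
    [IsProbabilityMeasure P] (hJ : HasGaussianLaw (fun ω (b : B) => Φ b ω) P) (hΦ : ∀ b ∈ B, Measurable (Φ b))
    (h0 : ∀ b ∈ B, P[Φ b] = 0) {c₀ : ℝ} (hc₀ : 0 < c₀) (hcb : ∀ b ∈ B, c₀ ≤ c b) (hV : ∀ Y ∈ Ys, Measurable (V Y))
    {KY : υ → ℝ} (hK : ∀ Y ∈ Ys, ∀ ω, |V Y ω| ≤ KY Y) (hek : 0 < ek) (hek1 : ek < Real.exp (-1))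
    {α : Type*} [Fintype α] [DecidableEq α] {nbar : ℕ} (hα : Fintype.card α = nbar + 1) (s₀ : ↥B ⊕ ↥Ys)
    {κ : ℝ → Finset α → (α → ↥B ⊕ ↥Ys) → ℝ}
    (hκ : ∀ t ∈ Set.Ioc (0 : ℝ) 1, ∀ γ, ∀ K : Finset α, K.Nonempty →
      slotMoment χ p ek B Φ c Ys V P t K γ = ∑ π ∈ setPartitions K, ∏ A ∈ π, κ t A γ) :
    -Real.log (zt χ p ek B Φ c Ys V P 1) = pertP (fun t => Real.log (zt χ p ek B Φ c Ys V P t)) nbar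
        + (nbar + 1 : ℝ) * remR (fun t => ∑ γ : α → ↥B ⊕ ↥Ys, κ t Finset.univ γ) nbar ∧
      -Real.log (zt χ p ek B Φ c Ys V P 1) = pertP (fun t => Real.log (zt χ p ek B Φ c Ys V P t)) nbar
        + ∫ t in (0 : ℝ)..1, -((1 - t) ^ nbar / nbar.factorial) * ∑ γ : α → ↥B ⊕ ↥Ys, κ t Finset.univ γ := by
  have hc : ∀ b ∈ B, c b ≠ 0 := fun b hb => (hc₀.trans_le (hcb b hb)).ne'
  have hzpos : ∀ x ∈ Set.Ioc (0 : ℝ) 1, 0 < zt χ p ek B Φ c Ys V P x := fun x hx =>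
    zt_pos χ hχ (by linarith) P hJ hΦ h0 hc₀ hcb hV hK hek hx.1
      (BIJ88ZtPositivity308.mul_le_exp_neg_one_of_Ioc hek hek1.le hx)
  have hR := remR_sum_trunc_eq_zt χ P hΦ hc hV hK hek hek1 hzpos hα s₀ hκ
  have hT := taylor_logz (nbar := nbar)
    (contDiffOn_uIcc_log_zt χ hχ hp P hJ hΦ h0 hc₀ hcb hV hK hek hek1 (nbar + 1))
  rw [zt_zero χ (by linarith) P, Real.log_one, zero_sub] at hT
  rw [← succ_mul_remR]
  have hn : ((nbar : ℝ) + 1) ≠ 0 := Nat.cast_add_one_ne_zero nbar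
  refine ⟨?_, ?_⟩ <;>
  · rw [hT, hR]
    field_simp
    ring

end Moments

end Literature.MathematicalPhysics.QuantumFieldTheory.BalabanImbrieJaffe1984to88.BIJ88SlotMoments308

end
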